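import Mathlib
import Literature.NumberTheory.LFunctions.WeilExplicit
import Literature.NumberTheory.LFunctions.RiemannXi
import Literature.NumberTheory.LFunctions.RiemannXiFourier
import Literature.NumberTheory.LFunctions.WeilMellinInversion
import Literature.Analysis.Complex.StripResidueFormula

/-!
# Stub `stub_mellinXi` of the line `Sketch`
(crux `WeilGroundState.GroundStatesConvergeToXi`, item stmt-RiemannHypothesis-1527)

**The Mellin–Laplace transform of Riemann's kernel is `ξ`.**  With `Φ(t) := 2Ψ(2t)`, where
`Ψ = LagariasMontague.Psic` is Riemann's kernel in the normalisation of
`Literature/NumberTheory/LFunctions/RiemannXiFourier.lean` (`ξ(1/2 + it) = 𝓕 Ψ (t/4π)`), the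
theorem `stub_mellinXi` says that for EVERY `s : ℂ`
`weilMellin Φ s = ∫ Φ(t) e^{(s - 1/2)t} dt = riemannXi s`.

Proof.
1. *Critical line* (`weilMellin_phi_criticalLine`): substituting `u = 2t`,
   `weilMellin Φ (1/2 + iτ) = ∫ Ψ(u) e^{iτu/2} du = 𝓕 Ψ (−τ/4π) = ξ(1/2 − iτ) = ξ(1/2 + iτ)`
   (`LagariasMontague.riemannXi_criticalLine_eq_fourier`,
   `LagariasMontague.riemannXi_criticalLine_neg`).
2. *Entirety* (`hasDerivAt_weilMellin_of_moments`): differentiation under the integral sign,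
   dominated on the ball `‖s − s₀‖ < 1` by `‖Φ(t)‖ |t| e^{(‖s₀‖+2)|t|}` (the pattern of
   `Literature.NumberTheory.LFunctions.hasDerivAt_weilMellin` /
   `IsWeilGroundState.hasDerivAt_weilMellin`); the Mellin integrand is integrable by the
   exponential-moment hypothesis and the dominating function by the super-exponential decay
   hypothesis `|Ψ(t)| ≤ C_c e^{−c|t|}` (all `c`) and
   `Literature.Analysis.Complex.integrable_exp_neg_mul_abs` (`e^{−|t|} ∈ L¹`).
3. *Identity theorem*: both sides are entire (`differentiable_riemannXi`) and agree on the
   vertical line through `1/2`, which accumulates at `1/2`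
   (`AnalyticOnNhd.eqOn_of_preconnected_of_frequently_eq`).
-/

set_option linter.dupNamespace false

noncomputable section

open MeasureTheory Complex Filter Set
open scoped Real Topology FourierTransform

namespace Summit.RiemannHypothesis.RiemannHypothesis.Theorems.GroundStatesConvergeToXi

open Literature.NumberTheory.LFunctions

/-! ## Entirety of `weilMellin Φ` under moment hypotheses -/

section Moments

variable {Φ : ℝ → ℂ}

/-- **Differentiation under the integral sign.** If `Φ` is continuous, every Mellin integrand
`Φ(t) e^{(s-1/2)t}` is integrable and every weighted moment `‖Φ(t)‖ |t| e^{A|t|}` is integrable,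
then `Φ̂ = weilMellin Φ` is complex-differentiable at every `s₀`, with
`Φ̂'(s₀) = ∫ Φ(t) t e^{(s₀-1/2)t} dt` (dominated on the ball `‖s − s₀‖ < 1` by
`‖Φ(t)‖ |t| e^{(‖s₀‖+2)|t|}`). [folklore] -/
theorem hasDerivAt_weilMellin_of_moments (hΦc : Continuous Φ)
    (hF : ∀ s : ℂ, Integrable fun t : ℝ => Φ t * cexp ((s - 1 / 2) * t))
    (hM : ∀ A : ℝ, Integrable fun t : ℝ => ‖Φ t‖ * (|t| * Real.exp (A * |t|))) (s₀ : ℂ) :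
    HasDerivAt (weilMellin Φ) (∫ t : ℝ, Φ t * (t * cexp ((s₀ - 1 / 2) * t))) s₀ := by
  -- adapted from `Literature.NumberTheory.LFunctions.hasDerivAt_weilMellin`
  -- (Literature/NumberTheory/LFunctions/WeilMellinInversion.lean)
  set A : ℝ := ‖s₀‖ + 2 with hA
  have hF_meas : ∀ᶠ s in 𝓝 s₀,
      AEStronglyMeasurable (fun t : ℝ => Φ t * cexp ((s - 1 / 2) * t)) volume :=
    Eventually.of_forall fun s =>
      (hΦc.mul (by fun_prop : Continuous fun t : ℝ => cexp ((s - 1 / 2) * t))).aestronglyMeasurable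
  have hF_int : Integrable (fun t : ℝ => Φ t * cexp ((s₀ - 1 / 2) * t)) := hF s₀
  have hF'_meas :
      AEStronglyMeasurable (fun t : ℝ => Φ t * (t * cexp ((s₀ - 1 / 2) * t))) volume :=
    (hΦc.mul (by fun_prop : Continuous fun t : ℝ => (t : ℂ) * cexp ((s₀ - 1 / 2) * t))
      ).aestronglyMeasurable
  have h_bound : ∀ᵐ t : ℝ, ∀ s ∈ Metric.ball s₀ 1,
      ‖Φ t * (t * cexp ((s - 1 / 2) * t))‖ ≤ ‖Φ t‖ * (|t| * Real.exp (A * |t|)) := by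
    refine Eventually.of_forall fun t s hs => ?_
    rw [norm_mul, norm_mul, Complex.norm_exp, Complex.norm_real, Real.norm_eq_abs]
    refine mul_le_mul_of_nonneg_left (mul_le_mul_of_nonneg_left (Real.exp_le_exp.2 ?_)
      (abs_nonneg _)) (norm_nonneg _)
    have hre : ((s - 1 / 2) * (t : ℂ)).re = (s.re - 1 / 2) * t := by simp [sub_re, mul_re]
    rw [hre]
    have hs' : ‖s - s₀‖ < 1 := by rwa [Metric.mem_ball, dist_eq_norm] at hs
    have h1 : |(s - s₀).re| ≤ ‖s - s₀‖ := abs_re_le_norm _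
    have h2 : |s₀.re| ≤ ‖s₀‖ := abs_re_le_norm _
    have h3 : |s.re - 1 / 2| ≤ A := by
      have e : s.re - 1 / 2 = (s - s₀).re + s₀.re + (-(1 / 2)) := by simp; ring
      rw [e, hA]
      refine (abs_add_three _ _ _).trans ?_
      rw [abs_neg, abs_of_pos (by norm_num : (0 : ℝ) < 1 / 2)]
      linarith
    calc (s.re - 1 / 2) * t ≤ |(s.re - 1 / 2) * t| := le_abs_self _
      _ = |s.re - 1 / 2| * |t| := abs_mul _ _
      _ ≤ A * |t| := mul_le_mul_of_nonneg_right h3 (abs_nonneg _)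
  have h_diff : ∀ᵐ t : ℝ, ∀ s ∈ Metric.ball s₀ 1,
      HasDerivAt (fun s : ℂ => Φ t * cexp ((s - 1 / 2) * t))
        (Φ t * (t * cexp ((s - 1 / 2) * t))) s :=
    Eventually.of_forall fun t s _ => hasDerivAt_weilIntegrand Φ t s
  exact (hasDerivAt_integral_of_dominated_loc_of_deriv_le (Metric.ball_mem_nhds s₀ one_pos)
    hF_meas hF_int hF'_meas h_bound (hM A) h_diff).2

end Moments

/-! ## Riemann's kernel `Φ(t) = 2Ψ(2t)` -/

/-- `Φ(t) = 2Ψ(2t)` is continuous. [folklore] -/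
theorem continuous_phi : Continuous fun t : ℝ => (2 : ℂ) * LagariasMontague.Psic (2 * t) :=
  continuous_const.mul (LagariasMontague.continuous_Psic.comp (continuous_const.mul continuous_id))

/-- `‖Φ(t)‖ = 2|Ψ(2t)|`. [folklore] -/
theorem norm_phi (t : ℝ) :
    ‖(2 : ℂ) * LagariasMontague.Psic (2 * t)‖ = 2 * |LagariasMontague.Psi (2 * t)| := by
  rw [norm_mul, Complex.norm_ofNat, LagariasMontague.Psic, Complex.norm_real, Real.norm_eq_abs]

/-- The Mellin integrand `Φ(t) e^{(s-1/2)t}` is integrable for every `s`, from the exponential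
moments `∫ |Ψ(2t)| e^{c|t|} dt < ∞`. [folklore] -/
theorem integrable_phi_mul_cexp
    (hint : ∀ c : ℝ, Integrable (fun t : ℝ => LagariasMontague.Psi (2 * t) * Real.exp (c * |t|)))
    (s : ℂ) :
    Integrable fun t : ℝ => 2 * LagariasMontague.Psic (2 * t) * cexp ((s - 1 / 2) * t) := by
  refine (((hint |s.re - 1 / 2|).norm).const_mul 2).mono'
    ((continuous_phi.mul (by fun_prop : Continuous fun t : ℝ => cexp ((s - 1 / 2) * t))
      ).aestronglyMeasurable) (ae_of_all _ fun t => ?_)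
  rw [norm_mul, norm_phi, Complex.norm_exp]
  simp only [norm_mul, Real.norm_eq_abs, Real.abs_exp]
  have hre : ((s - 1 / 2) * (t : ℂ)).re = (s.re - 1 / 2) * t := by simp [sub_re, mul_re]
  rw [hre]
  have h : (s.re - 1 / 2) * t ≤ |s.re - 1 / 2| * |t| := by
    rw [← abs_mul]
    exact le_abs_self _
  have h' := Real.exp_le_exp.2 h
  rw [mul_assoc]
  exact mul_le_mul_of_nonneg_left (mul_le_mul_of_nonneg_left h' (abs_nonneg _)) two_pos.le

/-- The weighted moments `‖Φ(t)‖ |t| e^{A|t|}` are integrable for every `A`, from the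
super-exponential decay `|Ψ(t)| ≤ C_c e^{−c|t|}` (rate `c = |A| + 2`) and `|t| ≤ e^{|t|}`:
`‖Φ(t)‖ |t| e^{A|t|} ≤ 2 C e^{−|t|}`. [folklore] -/
theorem integrable_norm_phi_mul
    (hdecay : ∀ c : ℝ, ∃ C : ℝ, ∀ t : ℝ, |LagariasMontague.Psi t| ≤ C * Real.exp (-(c * |t|)))
    (A : ℝ) :
    Integrable fun t : ℝ =>
      ‖(2 : ℂ) * LagariasMontague.Psic (2 * t)‖ * (|t| * Real.exp (A * |t|)) := by
  obtain ⟨C, hC⟩ := hdecay (|A| + 2)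
  have hC0 : 0 ≤ C := by simpa using (abs_nonneg _).trans (hC 0)
  refine ((Literature.Analysis.Complex.integrable_exp_neg_mul_abs one_pos).const_mul (2 * C)).mono'
    ((continuous_phi.norm.mul (by fun_prop)).aestronglyMeasurable) (ae_of_all _ fun t => ?_)
  rw [Real.norm_of_nonneg (by positivity), norm_phi]
  have h1 : |t| ≤ Real.exp |t| := by linarith [Real.add_one_le_exp |t|]
  have h2 : |LagariasMontague.Psi (2 * t)| ≤ C * Real.exp (-((|A| + 2) * |2 * t|)) := hC (2 * t)
  have h3 : Real.exp (-((|A| + 2) * |2 * t|)) * (Real.exp |t| * Real.exp (A * |t|)) ≤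
      Real.exp (-1 * |t|) := by
    rw [← Real.exp_add, ← Real.exp_add, Real.exp_le_exp, abs_mul, abs_two]
    nlinarith [mul_le_mul_of_nonneg_right (le_abs_self A) (abs_nonneg t), abs_nonneg t,
      mul_nonneg (abs_nonneg A) (abs_nonneg t)]
  calc 2 * |LagariasMontague.Psi (2 * t)| * (|t| * Real.exp (A * |t|))
      ≤ 2 * |LagariasMontague.Psi (2 * t)| * (Real.exp |t| * Real.exp (A * |t|)) := by gcongr
    _ ≤ 2 * (C * Real.exp (-((|A| + 2) * |2 * t|))) * (Real.exp |t| * Real.exp (A * |t|)) := by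
        gcongr
    _ = 2 * C * (Real.exp (-((|A| + 2) * |2 * t|)) * (Real.exp |t| * Real.exp (A * |t|))) := by
        ring
    _ ≤ 2 * C * Real.exp (-1 * |t|) := mul_le_mul_of_nonneg_left h3 (by positivity)

/-! ## The critical line: `Φ̂(1/2 + iτ) = ξ(1/2 + iτ)` -/

/-- **Riemann's formula on the critical line**: `weilMellin Φ (1/2 + iτ) = ξ(1/2 + iτ)` for every
real `τ` (substitute `u = 2t` in `∫ 2Ψ(2t) e^{iτt} dt` to get
`𝓕 Ψ (−τ/4π) = ξ(1/2 − iτ) = ξ(1/2 + iτ)`, `LagariasMontague.riemannXi_criticalLine_eq_fourier`).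
[folklore] -/
theorem weilMellin_phi_criticalLine (τ : ℝ) :
    weilMellin (fun t : ℝ => 2 * LagariasMontague.Psic (2 * t)) (1 / 2 + τ * I) =
      riemannXi (1 / 2 + τ * I) := by
  rw [← LagariasMontague.riemannXi_criticalLine_neg τ,
    LagariasMontague.riemannXi_criticalLine_eq_fourier (-τ), Real.fourier_real_eq_integral_exp_smul]
  set g : ℝ → ℂ := fun v => LagariasMontague.Psic v * cexp (↑(v * τ / 2) * I) with hg
  have h1 : weilMellin (fun t : ℝ => 2 * LagariasMontague.Psic (2 * t)) (1 / 2 + τ * I) =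
      2 * ∫ t : ℝ, g (2 * t) := by
    rw [← integral_const_mul]
    simp only [weilMellin, hg]
    refine integral_congr_ae (ae_of_all _ fun t => ?_)
    dsimp only
    have e : (1 / 2 + (τ : ℂ) * I - 1 / 2) * (t : ℂ) = ((2 * t * τ / 2 : ℝ) : ℂ) * I := by
      push_cast
      ring
    rw [e, mul_assoc]
  have h2 : ∫ v : ℝ, cexp (↑(-2 * π * v * (-τ / (4 * π))) * I) • LagariasMontague.Psic v =
      ∫ v : ℝ, g v := by
    refine integral_congr_ae (ae_of_all _ fun v => ?_)
    dsimp only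
    have e : -2 * π * v * (-τ / (4 * π)) = v * τ / 2 := by
      field_simp
      ring
    rw [smul_eq_mul, mul_comm, e]
  rw [h1, h2, Measure.integral_comp_mul_left g 2, abs_of_pos (by positivity : (0 : ℝ) < 2⁻¹),
    Complex.real_smul]
  push_cast
  ring

/-! ## The stub: `Φ̂ = ξ` on `ℂ` -/

/-- **Stub `stub_mellinXi` — `Φ̂ = ξ` (RH-free).** With `Φ(t) = 2Ψ(2t)` Riemann's kernel
(`LagariasMontague.Psic`), `weilMellin Φ s = ∫ Φ(t) e^{(s-1/2)t} dt = riemannXi s` for EVERY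
`s : ℂ`: on the critical line this is `riemannXi_criticalLine_eq_fourier` after `u = 2t`
(`weilMellin_phi_criticalLine`); both sides are entire (`hasDerivAt_weilMellin_of_moments`, fed
by the exponential moments `hint` and the super-exponential decay `hdecay`;
`differentiable_riemannXi`), and the vertical line through `1/2` accumulates at `1/2`, so the
identity theorem extends the equality to `ℂ`. [folklore] -/
theorem stub_mellinXi
    (hdecay : ∀ c : ℝ, ∃ C : ℝ, ∀ t : ℝ, |LagariasMontague.Psi t| ≤ C * Real.exp (-(c * |t|)))
    (hint : ∀ c : ℝ, Integrable (fun t : ℝ => LagariasMontague.Psi (2 * t) * Real.exp (c * |t|)))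
    (s : ℂ) :
    weilMellin (fun t : ℝ => 2 * LagariasMontague.Psic (2 * t)) s = riemannXi s := by
  have hD : Differentiable ℂ (weilMellin fun t : ℝ => 2 * LagariasMontague.Psic (2 * t)) :=
    fun s₀ => (hasDerivAt_weilMellin_of_moments continuous_phi (integrable_phi_mul_cexp hint)
      (integrable_norm_phi_mul hdecay) s₀).differentiableAt
  have hF : AnalyticOnNhd ℂ (weilMellin fun t : ℝ => 2 * LagariasMontague.Psic (2 * t)) univ :=
    hD.differentiableOn.analyticOnNhd isOpen_univ
  have hX : AnalyticOnNhd ℂ riemannXi univ :=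
    differentiable_riemannXi.differentiableOn.analyticOnNhd isOpen_univ
  have htend : Tendsto (fun τ : ℝ => (1 / 2 : ℂ) + τ * I) (𝓝[>] 0) (𝓝[≠] (1 / 2 : ℂ)) := by
    have hc : Continuous fun τ : ℝ => (1 / 2 : ℂ) + τ * I := by fun_prop
    have hmaps : MapsTo (fun τ : ℝ => (1 / 2 : ℂ) + τ * I) (Ioi 0) {(1 / 2 : ℂ)}ᶜ := by
      intro τ hτ hmem
      have h : (1 / 2 : ℂ) + τ * I = 1 / 2 := hmem
      have him := congrArg Complex.im h
      simp at him
      exact (ne_of_gt hτ) him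
    have h1 : Tendsto (fun τ : ℝ => (1 / 2 : ℂ) + τ * I) (𝓝[>] 0)
        (𝓝[{(1 / 2 : ℂ)}ᶜ] ((1 / 2 : ℂ) + (0 : ℝ) * I)) :=
      hc.continuousWithinAt.tendsto_nhdsWithin hmaps
    simpa using h1
  have hfreq : ∃ᶠ z in 𝓝[≠] (1 / 2 : ℂ),
      weilMellin (fun t : ℝ => 2 * LagariasMontague.Psic (2 * t)) z = riemannXi z :=
    htend.frequently (Eventually.of_forall weilMellin_phi_criticalLine).frequently
  exact hF.eqOn_of_preconnected_of_frequently_eq hX isPreconnected_univ (mem_univ _) hfreq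
    (mem_univ s)

end Summit.RiemannHypothesis.RiemannHypothesis.Theorems.GroundStatesConvergeToXi

end
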